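import Literature.NumberTheory.EllipticCurves.BurungaleCastellaSkinner2025.BDPMainConjectureRationalAtTrivialCharacter
import HarnessLib

/-!
# Yan–Zhu 2026, Thm. 5.7 (1), RATIONAL clause (the anticyclotomic BDP main conjecture for
# `𝒳_{𝓕_Gr}(E/K_∞⁻)` in `Λ_K^{ur,−} ⊗ ℚ_p` at an ODD good ordinary prime under (irr_K) ONLY — no
# image hypothesis) + Burungale–Castella–Skinner 2025 Prop. 4.2.2 (`μ(L_p^BDP) = 0`, Hsieh) AT THE
# TRIVIAL CHARACTER, combined with Castella–Grossi–Lee–Skinner 2022 Thm. 5.1.3 (the BDP formula):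
# `𝓕(0) = u · p^k · c_E⁻² (1 − a_p p⁻¹ + p⁻¹)² log_{ω_E}(P_K)²` with `k ≥ 0` — the `p ≥ 3` twin of
# `BurungaleCastellaSkinner2025/BDPMainConjectureRationalAtTrivialCharacter.lean` (BCS Thm. 1.2.4 (a),
# printed for `p > 3` under (irr_ℚ))

HONEST FRAMING. This file TYPES a composite of three PUBLISHED theorems as ONE named fact
(`def … : Prop`, nothing asserted, no `_holds`; D-0014/D-0026) in the tree's EXISTING vocabulary —
the Literature object `Castella2018.AcSelmer.XAc` and the log reading of `PadicFormalLogOrder.lean`,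
LETTER FOR LETTER the statement of its `p > 3` sibling
`BurungaleCastellaSkinner2025.thm124a_prop422_thm513_generator_constantCoeff` (p533331) with the binder
`3 < p` replaced by `3 ≤ p` and the binder `Irr W p` ((irr_ℚ), which none of the three sources needs)
dropped — and proves only bookkeeping consumers, among them the porting term "this fact ⟹ the
sibling". Typed ≠ proved ≠ endorsed. Written by the typer seat `bsd-print-x9-ty1` of cell
`run/shared/lean/pub/bsd-print-x9/` (D-0131 print tier; leaves X9 = irreducible NON-surjective image
at a good ordinary `p ∈ {5, 7}` and X10b = the same at `p = 3`): on X10b every main-conjecture-level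
input of the Heegner road typed so far is DEAD — BCS 2025 Thm. 1.2.4 (a)/(b) print `p > 3`, and the
Yan–Zhu composites already in the tree (`YanZhu2026.thm412_thm513_generator_constantCoeff`,
`YanZhu2026.cor54_prop342_thm513_generator_constantCoeff`) carry the big-image binder `BigIm W p`
(their integral clause). The RATIONAL clause of Yan–Zhu's Theorem 5.7 (1) is printed at every `p > 2`
with `ρ̄_E|_{G_K}` irreducible and NO image hypothesis; combined with `μ(L_p^BDP) = 0` (BCS Prop.
4.2.2, also `p > 2`) it gives the ONE-SIDED (lower) bound on `ord_p 𝓕(0)` that the rank-one `p`-part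
of BSD consumes (STEP L of Jetchev–Skinner–Wan §7.4.1; the cells' Summits predicate
`X11b.IMCLowerWaldspurgerOnTreeGoodAt`), now at `p = 3` as well.

## Sources (read on: the arXiv **v4** TeX of Yan–Zhu held at
## `run/shared/lean/b2b/bsd-rank1-residual/b2b-bsdres-lit/g98/eprints/yz_v4/main.tex` (the revision
## carrying the journal DOI; line numbers `l.NNNN` below are lines of that file); the store text
## `paper:arxiv-2405.00270` of BCS (= arXiv v2, pages `p00NN`); the CGLS arXiv v2 TeX `Eisenstein.tex`
## (`…/g98/eprints/cgls_v2.bin`, lines `L NNNN`))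

* **[YanZhu2024MainConjNonCM]** X. Yan, X. Zhu, *Main conjectures for non-CM elliptic curves at good
  ordinary primes*, J. Algebra **693** (2026) 372–402, doi:10.1016/j.jalgebra.2026.01.016 =
  arXiv:2412.20078v4. REFEREED / PUBLISHED (the typed siblings `YanZhu2026/AnticyclotomicMainTheorems.lean`
  — Thm. 5.7 (1)/(2) as main-conjecture-level facts — and `YanZhu2026/PPartBSD.lean`).
  Setting of §5.2 (l.1189–1190, verbatim): "Let `E/ℚ` be an elliptic curve of conductor `N`, let
  `p > 2` be a prime such that `E` has good ordinary reduction at `p`, and let `K` be an imaginary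
  quadratic field such that `p𝒪_K = 𝔭𝔭̄` splits in `K` and the pair `(E, K)` satisfies the Heegner
  hypothesis. Assume that the residual representation `ρ̄_E|_{G_K} : G_K → Aut(E[p])` is irreducible."
  §3.5 (l.882, verbatim, where `𝓛_p^BDP` lives): "Assume that `D_K` is odd, `D_K ≠ −3`, and that the
  Heegner hypothesis holds. Fix an integral ideal `𝔫 ⊂ 𝒪_K` satisfying `𝒪_K/𝔫 ≃ ℤ/Nℤ`. Define
  `Λ_K^{ur,±} := Λ_K^± ⊗̂ ℤ_p^ur`." Thm. 3.13 (l.883–892): "There exists an element `𝓛_p^BDP(f/K) ∈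
  Λ_K^{ur,−}` characterized by the following interpolation property […]. *Proof.* This was originally
  constructed in [BDP] […]. See [CGLS, Theorem 2.1.1] for this refined construction".
  **Theorem 5.7 (1)** (`\label{ac}`, l.1217–1227, verbatim): "(1) `𝒳_{𝓕_Gr}(E/K_∞⁻)` is
  `Λ_K⁻`-torsion and `Char_{Λ_K⁻}(𝒳_{𝓕_Gr}(E/K_∞⁻))Λ_K^{ur,−} ⊗ ℚ_p = (𝓛_p^BDP(E/K))` holds in
  `Λ_K^{ur,−} ⊗ ℚ_p`. Moreover, if the representation `ρ_E|_{G_K} : G_K → Aut_{ℤ_p}(T_pE)` is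
  surjective, then `Char_{Λ_K⁻}(𝒳_{𝓕_Gr}(E/K_∞⁻))Λ_K^{ur,−} = (𝓛_p^BDP(E/K))`." ONLY THE FIRST
  SENTENCE (the rational clause) is used here. Its printed proof (l.1294–1302): "Since
  `𝓛_p^BDP(E/K)` is non-zero ([BCK, Cor. 4.5]), by the arguments presented in Section 4 [the
  two-variable main conjecture], there exists a nontrivial multiplicative set `S ⊂ Λ_K⁺ ⊂ Λ_K` such that
  […] `S⁻¹Char_{Λ_K}(𝒳_{𝓕_Gr}(E/K_∞))Λ_K^ur ⊂ (𝓛_p^Gr(E/K))`. By Lemma [bdp_des] […]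
  `Char_{Λ_K⁻}(𝒳_{𝓕_Gr}(E/K_∞⁻))Λ_K^{ur,−} ⊗ ℚ_p ⊂ (𝓛_p^BDP(E/K))`. The reverse divisibility is
  established by combining Theorem 5.8 [= CGS Thm. 6.5.2 (+ Howard Thm. B for the integral clause)]
  and Theorem 5.9 ["Arguing as in [BCK, Theorem 5.2]"]."
* **[BurungaleCastellaSkinner2025]** A. Burungale, F. Castella, C. Skinner, IMRN **2025** rnaf082 =
  arXiv:2405.00270v2. **Proposition 4.2.2** (p. 9, `[p0009 L2–L7]`, verbatim): "Let `g ∈ S₂(Γ₀(N))`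
  be an elliptic newform with good reduction at `p > 2`, and suppose `K` is an imaginary quadratic
  field satisfying (disc), (Heeg), (spl), and (irr_K). Then `μ(L_p^Gr(g/K)) = μ(L_p^BDP(g/K)) = 0`.
  *Proof.* By [Hsi14, Thm. B], `L_p^BDP(g/K)` has vanishing `μ`-invariant. …" with (disc) "`D_K` is
  odd and `D_K ≠ −3`" `[p0002 L34]`, (Heeg)/(spl) `[p0002 L35–L39]`, (irr_K) "`ρ̄_g` is irreducible as
  `G_K`-representation" `[p0007 L54]`.
* **[CastellaGrossiLeeSkinner2022]** F. Castella, G. Grossi, J. Lee, C. Skinner, Invent. Math. **227**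
  (2022). **Thm. 5.1.3** (`\label{thmpadicGZ}`, `L2463–L2470`, verbatim; data of §5.1.2 `L2434–L2447`:
  `E/ℚ` of conductor `N`, `π : X₀(N) → E`, `K` with the Heegner hypothesis relative to `N`,
  `P_K = Σ_σ π(x₁)^σ ∈ E(K)`, `f` the newform of `E`, `c_E` the Manin constant, `π^*(ω_E) = c_E ω_f`):
  "Under the above hypotheses, let `p > 2` be a prime of good reduction for `E` such that `p = v v̄`
  splits in `K`. Then `𝓛_E(0) = c_E⁻² · (1 − a_p p⁻¹ + p⁻¹)² · log_{ω_E}(P_K)²`" — `𝓛_E` is CGLS's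
  Thm. 2.1.1 object, i.e. Yan–Zhu's `𝓛_p^BDP(f/K)` (their Thm. 3.13 IS [CGLS, Thm. 2.1.1]) and BCS's
  `L_p^BDP(E/K)` ([BDP13], [CH18, Prop. 3.8]). No image hypothesis (BDP13 Thm. 5.13 at `k = 2`).
* **[Hsieh2014]** M.-L. Hsieh, Doc. Math. **19** (2014), Thm. B — the source of Prop. 4.2.2 as cited by
  BCS; an ODD prime (tree files `Hsieh2014/AnticyclotomicMuInvariant*.lean`).

## The composite, and the two-line `μ`-comparison that assembles it (recorded for the referee)

Write `Λ = Λ_K⁻`, `R = Λ_K^{−,ur}` (a domain), `𝓕 ∈ Λ` a generator of the principal ideal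
`Char_Λ(𝒳_{𝓕_Gr}(E/K_∞⁻))` (torsion by Thm. 5.7 (1)), `L = 𝓛_p^BDP(E/K) ∈ R`. Thm. 5.7 (1), rational
clause: there are `a, b ≥ 0` and `w ∈ R^×` with `p^a · 𝓕 = w · p^b · L` in `R` ("equality in
`R ⊗ ℚ_p`"). Prop. 4.2.2: `μ(L) = 0`. Taking `μ`-invariants (additive on the domain `R`, `μ(p) = 1`,
`μ(w) = 0`, `μ(𝓕) ≥ 0`): `a + μ(𝓕) = b`, so `b − a = μ(𝓕) =: k ∈ ℕ` and `𝓕 = w · p^k · L`. At the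
trivial character: `𝓕(0) = w(0) · p^k · L(𝟙)` with `w(0) ∈ (ℤ_p^ur)^×`, and by CGLS Thm. 5.1.3
`L(𝟙) = c_E⁻² (1 − a_p p⁻¹ + p⁻¹)² log_{ω_E}(P_K)² ∈ K_v = ℚ_p`; so
**`𝓕(0) = u · p^k · c_E⁻² (1 − a_p p⁻¹ + p⁻¹)² log_{ω_E}(P_K)²` with `u ∈ ℚ_p ∩ (ℤ_p^ur)^× = ℤ_p^×`
and `k ∈ ℕ`** (when the value is `0`, `u := 1`, `k := 0` serve). The comparison is insensitive to the
`p`-power ambiguity of a rational equality: only `k ≥ 0` is kept. This is word for word the assembly of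
the sibling file, with BCS Thm. 1.2.4 (a) (`p > 3`, (irr_ℚ)) replaced by Yan–Zhu Thm. 5.7 (1)
(`p > 2`, (irr_K)).
REFEREE FLAGS offered with this fact (travel with it): `YZ26-57i+BCS422-mu-composite` — the displayed
identity is not printed as such; it is the three printed statements assembled by the `μ`-comparison
above (two lines of commutative algebra in `ℤ_p^ur⟦T⟧`). Inherited provenance at `p = 3`: the cell
flag `YZ26@3-BF-ERL-Ohta` of `YanZhu2026/PPartBSD.lean` (Thm. 5.7 (1)'s printed proof passes through
"the arguments presented in Section 4", i.e. the two-variable Thm. 4.2 and the Beilinson–Flach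
equivalence Thm. 4.7, whose explicit-reciprocity / `Λ`-adic Eichler–Shimura inputs at `p = 3` are the
flag's content — final wording of the b2b-bsdres referee rulings R9.1/R10.1/R361 quoted there), and
Thm. 5.9's "Arguing as in [BCK, Theorem 5.2]" (Burungale–Castella–Kim, ANT 15 (2021), printed for
`p > 3`; the cell's provisional flag on that pointer was retired, R9.1/R10.1, because the Howard-type
input of the rank-one leg is Castella–Grossi–Skinner 2025, published at `p ∤ 2N`). Reading flag
inherited from the siblings: `BCS-124-XGr-reading` (the tree object `AcSelmer.XAc … vbar ∅ γ` for
`𝒳_{𝓕_Gr}(E/K_∞⁻)` — relaxed at `𝔭` induced by `ι_p`, strict at `𝔭̄`, Yan–Zhu Def. 2.1 l.473–499 — is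
the one the typed Thm. 5.7 (1) `YanZhu2026.thm57_isTorsion_charIdealXGr_eq_bdpLFunction` already uses).
The statement below is the REFEREED statements' composite, valid as printed at every `p > 2`; the
flags concern proof-level inputs at `p = 3` and are not a claim that anything is false.

WHY A COMPOSITE AND NOT A DERIVATION (D-0026 bookkeeping, for the reviewer). The DERIVED road —
prove this statement from the typed `YanZhu2026.thm57_isTorsion_charIdealXGr_eq_bdpLFunction` (E-row
of Thm. 5.7 (1)), `BurungaleCastellaSkinner2025.prop422_exists_isBDPLFunction_mu_eq_zero` (E243) and a
CGLS 5.1.3 fact — is closed in the kernel by the SHAPE of those facts: each concludes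
`∃ (Ω_K, Ω_p, L), IsBDPLFunction … L ∧ …` for ITS OWN frame, and nothing in the tree identifies two
frames of `𝓛_p^BDP` (uniqueness of the interpolating series up to `Λ^{ur,×}` is not a printed statement
and is not formalised); in print all three theorems are about THE object `𝓛_p^BDP(f/K)` of Thm. 3.13
= [CGLS, Thm. 2.1.1], which is what the composite records. Same decision, same flag class, as the
sibling p533331 (cell referee verdict REF-6: PUB[composite], LITERAL for consumers).

STATUS 2026-08-27 (ty1 gen 16) — DERIVED. The preceding paragraph is now historical: the frame rigidity IS
formalised on the Summits side (`Summit.BirchSwinnertonDyer.Rank1Residual.X11b.R1.span_singleton_eq_of_isBDPLFunction`,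
`…X11b.constantCoeff_eq_of_isBDPLFunction`, cell b2b-bsdres), and with it this named fact is PROVED,
letter for letter, from the three single-source facts above plus Carayol's level fact, in
`Summits/BirchSwinnertonDyer/Rank1Residual/X11b/YZCompositeOfFrames.lean`:
`Summit.BirchSwinnertonDyer.Rank1Residual.X11b.YZComposite.thm57_bcs422_cgls513_of_printFacts (h57) (h422)
(h513 : CastellaGrossiLeeSkinner2022.thm513_exists_isBDPLFunction_valueAtOne_disc)
(hC : ∀ N, IsNewformOf.level_eq_conductorNorm)` (and `…_of_modularity … (hpar : nonempty_modularParametrizationData)`,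
which also yields the sibling p533331). The definition below is UNCHANGED; it stays a `def` here only
because Literature cannot import the Summits-side rigidity theorems.

## Transcription (tree vocabulary; binders = the sibling `thm124a_prop422_thm513_generator_constantCoeff`'s
## with `3 < p` REPLACED by `3 ≤ p` and `Irr W p` DROPPED)

* "`E/ℚ` of conductor `N`, `p > 2` good ordinary" = a globally minimal `W`, `3 ≤ p`, `GoodOrd W p`
  (the cells' `Rank1Residual` predicate); "`ρ̄_E|_{G_K}` irreducible" = (irr_K) =
  `(W.baseChange K).HasIrreducibleModPGaloisRep p` (for `K` quadratic with `(d_K, N) = 1` — automatic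
  under (Heeg) — and `p ≠ 2` it FOLLOWS from (irr_ℚ): Matar–Nekovář 2019 Prop. 5.26 (2), tree fact
  `MatarNekovar2019.prop526_hasIrreducibleModPGaloisRep_baseChange`).
* `K`: `IsImaginaryQuadratic K`; (Heeg) `SatisfiesHeegnerHypothesis (W.conductorNorm ℤ) K`; "`p𝒪_K =
  𝔭𝔭̄` splits" = (spl) `SatisfiesHeegnerHypothesis p K`; §3.5 / (disc) `Odd (discr K) ∧ discr K ≠ -3`.
* "`𝔭` induced by `ι_p`, `𝔭̄`", "`Γ_K⁻`, `Λ_K⁻`", "`𝒳_{𝓕_Gr}(E/K_∞⁻)`": EXACTLY the sibling's binders: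
  `ι : K →+* ℚ_[p]`, `v` with `x ∈ v ⟺ ‖ι x‖ < 1`, `vbar ∋ p`, `vbar ≠ v`; `κ` anticyclotomic with
  topological generator `γ`; `𝒳_{𝓕_Gr}(E/K_∞⁻) = AcSelmer.XAc (W.baseChange K) p κ vbar ∅ γ`.
* "`π`, `c_E`, `P_K`, `log_{ω_E}(P_K)`": EXACTLY the sibling's `(Dt, H, ιC, P)` (`Dt :
  ModularParametrizationData W N` carries the newform of `W`, so `N = N_E`) and
  `log_W(z(m₀ • P_ι))/m₀` (`padicLogPoint`, `formalIndex`, `padicPointOf`).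
* Conclusion: `𝒳_{𝓕_Gr}` is `Λ`-torsion and there is a generator `F` of `Char_Λ(𝒳_{𝓕_Gr})`, a unit
  `u ∈ ℤ_p^×` and `k : ℕ` with `F(0) = u · p^k · c_E⁻² · (1 − a_p p⁻¹ + p⁻¹)² · log_{ω_E}(P_K)²` in
  `ℚ_p`. COMPOSITE OF THREE PRINTED, PUBLISHED THEOREMS; WEAKER than their conjunction (only the
  value at `𝟙` of the divisibility `L ∣ 𝓕` is kept); nothing asserted.

## Contents

* `thm57_bcs422_cgls513_generator_constantCoeff` — the named fact (ONE new `def … : Prop`).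
* PROVED: `BurungaleCastellaSkinner2025.thm124a_prop422_thm513_generator_constantCoeff_of_thm57`
  (this fact ⟹ the `p > 3` sibling p533331, whose binders are a superset: every consumer of the
  sibling — e.g. the X9 leaf kernel `Rank1Residual.bsdpOnClassX9_of_heegnerDivisibilityX9_of_katoMuTransfer`
  (binder `h124a`) — is fed by this fact too); `generator_constantCoeff_eq_of_thm57`,
  `le_valuation_generator_constantCoeff_of_thm57`, `hasCharValuationAt_ge_of_thm57` (the packaged
  shape `∃ n, AcSelmer.XAc.HasCharValuationAt … n ∧ 2·(ord_p(1 − a_p + p) − 1 + ord_p log_{ω_E} P_K)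
  − 2·ord_p c_E ≤ n`, at every `p ≥ 3`).

## References
* [YanZhu2024MainConjNonCM] J. Algebra 693 (2026) 372–402 = arXiv:2412.20078v4: §5.2 setting
  (l.1189–1190), Thm. 5.7 (1) (l.1217–1227), its proof (l.1246–1308), Rem. 5.10 (l.1310–1312);
  §3.5 (l.880–903: Thm. 3.13, Prop. 3.14); Def. 2.1 (l.473–499). = arXiv v2 §4.5, Thm. 4.12 (1).
* [BurungaleCastellaSkinner2025] IMRN 2025 rnaf082 = arXiv:2405.00270v2: Prop. 4.2.2 (p. 9), §1.2
  ((disc)/(Heeg)/(spl), pp. 2–3), (irr_K) (p. 7).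
* [CastellaGrossiLeeSkinner2022] Invent. Math. 227 (2022): Thm. 5.1.3 with §5.1.2; Thm. 2.1.1.
* [Hsieh2014] Doc. Math. 19 (2014), Thm. B. [BertoliniDarmonPrasanna2013] Duke Math. J. 162: Thm. 5.13.
* [MatarNekovar2019] JTNB 31 (2019), Prop. 5.26 (2) (the (irr_K) binder from (irr_ℚ)).
* Tree: the `p > 3` sibling `BurungaleCastellaSkinner2025/BDPMainConjectureRationalAtTrivialCharacter.lean`
  (p533331), `YanZhu2026/AnticyclotomicMainTheorems.lean` (Thm. 5.7 (1)/(2) on the frame),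
  `YanZhu2026/BDPMainConjectureAtTrivialCharacter.lean` (the (Im)-integral composite),
  `CastellaGrossiLeeSkinner2022/BDPValueAtTrivialCharacter.lean` (A173, the Eisenstein twin).
-/

set_option autoImplicit false

noncomputable section

open scoped Classical

open WeierstrassCurve NumberField IsDedekindDomain Field Literature.NumberTheory.EllipticCurves
  Literature.NumberTheory.EllipticCurves.ModularForms Literature.NumberTheory.QuadraticFields
  Literature.NumberTheory.EllipticCurves.Rank1Residual
  Literature.NumberTheory.EllipticCurves.Castella2018

namespace Literature.NumberTheory.EllipticCurves.YanZhu2026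

/-- **Yan–Zhu, J. Algebra 693 (2026) 372–402 = arXiv:2412.20078v4, Theorem 5.7 (1), FIRST (rational)
sentence, and Burungale–Castella–Skinner, IMRN 2025 (rnaf082) = arXiv:2405.00270v2, Proposition 4.2.2,
at the trivial character, combined with Castella–Grossi–Lee–Skinner, Invent. Math. 227 (2022)
Theorem 5.1.3 (the Bertolini–Darmon–Prasanna formula).** Thm. 5.7 (1) (verbatim; setting of §5.2:
"`E/ℚ` an elliptic curve of conductor `N`, `p > 2` a prime such that `E` has good ordinary reduction
at `p`, `K` an imaginary quadratic field such that `p𝒪_K = 𝔭𝔭̄` splits in `K` and the pair `(E, K)`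
satisfies the Heegner hypothesis. Assume that the residual representation `ρ̄_E|_{G_K} : G_K →
Aut(E[p])` is irreducible"; §3.5: "`D_K` is odd, `D_K ≠ −3`", where `𝓛_p^BDP(f/K) ∈ Λ_K^{ur,−}` of
Thm. 3.13 = [CGLS, Thm. 2.1.1] lives): "(1) `𝒳_{𝓕_Gr}(E/K_∞⁻)` is `Λ_K⁻`-torsion and
`Char_{Λ_K⁻}(𝒳_{𝓕_Gr}(E/K_∞⁻))Λ_K^{ur,−} ⊗ ℚ_p = (𝓛_p^BDP(E/K))` holds in `Λ_K^{ur,−} ⊗ ℚ_p`." (The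
second, integral sentence — under full image of `ρ_E|_{G_K}` — is NOT used.) Prop. 4.2.2 (verbatim):
"Let `g ∈ S₂(Γ₀(N))` be an elliptic newform with good reduction at `p > 2`, and suppose `K` is an
imaginary quadratic field satisfying (disc), (Heeg), (spl), and (irr_K). Then `μ(L_p^Gr(g/K)) =
μ(L_p^BDP(g/K)) = 0`." CGLS Thm. 5.1.3 (verbatim, data of §5.1.2): "let `p > 2` be a prime of good
reduction for `E` such that `p = v v̄` splits in `K`. Then `𝓛_E(0) = c_E⁻² · (1 − a_p p⁻¹ + p⁻¹)² ·
log_{ω_E}(P_K)²`". COMBINED at the trivial character by the `μ`-comparison of the module docstring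
(`p^a 𝓕 = w p^b L`, `μ(L) = 0` ⟹ `𝓕 = w · p^{μ(𝓕)} · L` in `Λ^{−,ur}`): a generator `𝓕 ∈ Λ` of
`Char(𝒳_{𝓕_Gr}(E/K_∞⁻))` satisfies `𝓕(0) = u · p^k · c_E⁻² (1 − a_p p⁻¹ + p⁻¹)² log_{ω_E}(P_K)²` for
some `u ∈ ℤ_p^×` and `k ∈ ℕ` (`k = μ(𝓕)`; an identity in `K_v = ℚ_p`). TRANSCRIBED (module docstring
for the dictionary): `W` globally minimal, `3 ≤ p`, `GoodOrd W p`; `K` imaginary quadratic with (Heeg)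
for `N_E`, (spl), (disc) `D_K` odd `≠ −3`, (irr_K) `(W.baseChange K).HasIrreducibleModPGaloisRep p`;
`(ι, v, vbar, κ, γ)` and `𝒳_{𝓕_Gr}(E/K_∞⁻) = AcSelmer.XAc (W.baseChange K) p κ vbar ∅ γ` exactly as in
the typed Thm. 5.7 (1) `thm57_isTorsion_charIdealXGr_eq_bdpLFunction` and in the `p > 3` sibling
`BurungaleCastellaSkinner2025.thm124a_prop422_thm513_generator_constantCoeff` (relaxed at `v`, strict at
`v̄`; reading flag `BCS-124-XGr-reading`); `(Dt, H, ιC, P)` and `log_{ω_E}(P_K) = log_W(z(m₀ • P_ι))/m₀`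
exactly as there; conclusion: `𝒳_{𝓕_Gr}` is `Λ`-torsion and there is a generator `F` of
`Char_Λ(𝒳_{𝓕_Gr})`, `u ∈ ℤ_p^×` and `k : ℕ` with `F(0) = u · p^k · c_E⁻² · (1 − a_p p⁻¹ + p⁻¹)² ·
log_{ω_E}(P_K)²` in `ℚ_p`. COMPOSITE OF THREE PRINTED, PUBLISHED THEOREMS (flag
`YZ26-57i+BCS422-mu-composite`; inherited at `p = 3`: cell flag `YZ26@3-BF-ERL-Ohta`); nothing asserted.
[cite: YanZhu2024MainConjNonCM, Thm. 5.7 (1), first sentence (§5.2, arXiv:2412.20078v4 TeX l.1217–1223) with setting l.1189–1190, §3.5 l.882 and Thm. 3.13 l.883–892; proof l.1294–1302; = arXiv v2 Thm. 4.12 (1)]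
[cite: BurungaleCastellaSkinner2025, Prop. 4.2.2 (p. 9; arXiv:2405.00270v2 p0009 L2–L7) with (disc)/(Heeg)/(spl) (§1.2, p. 2 L34–L39) and (irr_K) (p. 7 L54)]
[cite: CastellaGrossiLeeSkinner2022, Thm. 5.1.3 (TeX `thmpadicGZ`, L2463–L2470) with §5.1.2 (L2434–L2447)]
[cite: Hsieh2014, Thm. B (the source of Prop. 4.2.2, as cited by BCS)]
[cite: BertoliniDarmonPrasanna2013, Thm. 5.13 (the source of Thm. 5.1.3)] -/
def thm57_bcs422_cgls513_generator_constantCoeff : Prop :=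
  ∀ (W : WeierstrassCurve ℚ) [W.IsElliptic] [W.IsGloballyMinimal] (p : ℕ) [Fact p.Prime],
    3 ≤ p → GoodOrd W p →
    ∀ (K : Type) [Field K] [NumberField K], IsImaginaryQuadratic K →
      SatisfiesHeegnerHypothesis (W.conductorNorm ℤ) K → SatisfiesHeegnerHypothesis p K →
      Odd (NumberField.discr K) → NumberField.discr K ≠ -3 →
      (W.baseChange K).HasIrreducibleModPGaloisRep p →
    ∀ (ι : K →+* ℚ_[p]) (v vbar : HeightOneSpectrum (𝓞 K)),
      (∀ x : 𝓞 K, x ∈ v.asIdeal ↔ ‖ι (x : K)‖ < 1) →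
      ((p : ℕ) : 𝓞 K) ∈ vbar.asIdeal → vbar ≠ v →
    ∀ (κ : ZpExtension K p), κ.IsAnticyclotomic →
    ∀ (γ : absoluteGaloisGroup K) [Fact (κ.IsTopGenerator γ)],
    ∀ (N : ℕ) [NeZero N] (Dt : ModularParametrizationData W N)
      (H : HeegnerDatum N (NumberField.discr K)) (ιC : K →+* ℂ) (P : (W.baseChange K).toAffine.Point),
      WeierstrassCurve.Affine.Point.map ιC.toRatAlgHom P = heegnerPointComplex Dt H →
      Module.IsTorsion (IwasawaAlgebra p) (AcSelmer.XAc (W.baseChange K) p κ vbar ∅ γ) ∧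
      ∃ F : IwasawaAlgebra p,
        AcSelmer.XAc.charIdeal (W.baseChange K) p κ vbar ∅ γ = Ideal.span {F} ∧
        ∃ (u : ℤ_[p]ˣ) (k : ℕ),
          ((PowerSeries.constantCoeff F : ℤ_[p]) : ℚ_[p]) =
            ((u : ℤ_[p]) : ℚ_[p]) * (p : ℚ_[p]) ^ k * ((Dt.c : ℚ_[p])⁻¹) ^ 2 *
              (1 - (W.frobeniusTrace p : ℚ_[p]) * (p : ℚ_[p])⁻¹ + (p : ℚ_[p])⁻¹) ^ 2 *
              ((W.baseChange ℚ_[p]).padicLogPoint (formalIndex W p • padicPointOf W p ι P) /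
                (formalIndex W p : ℚ_[p])) ^ 2

/-! ### Porting term: this fact feeds every consumer of the `p > 3` sibling -/

/-- **The Yan–Zhu-sourced composite implies the BCS-sourced one** (p533331,
`BurungaleCastellaSkinner2025.thm124a_prop422_thm513_generator_constantCoeff`): the latter's binders
(`3 < p`, `GoodOrd`, `Irr W p`, (irr_K), …) are a superset of the former's (`3 ≤ p`, `GoodOrd`,
(irr_K), …) and the conclusions are identical. So the X9 leaf kernel's binder `h124a` (and any other
consumer of the sibling) is served by this fact as well — with the provenance of Yan–Zhu Thm. 5.7 (1)
in place of BCS Thm. 1.2.4 (a) (bookkeeping only; which source a closure rests on is the referee's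
column, not the kernel's).
[cite: YanZhu2024MainConjNonCM, Thm. 5.7 (1) (arXiv:2412.20078v4 l.1217–1223)]
[cite: BurungaleCastellaSkinner2025, Thm. 1.2.4 (a) (p. 3) and Prop. 4.2.2 (p. 9)] -/
theorem _root_.Literature.NumberTheory.EllipticCurves.BurungaleCastellaSkinner2025.thm124a_prop422_thm513_generator_constantCoeff_of_thm57
    (h : thm57_bcs422_cgls513_generator_constantCoeff) :
    BurungaleCastellaSkinner2025.thm124a_prop422_thm513_generator_constantCoeff := by
  intro W _ _ p _ hp hord _ K _ _ hK hHN hHp hodd h3 hirrK ι v vbar hv hvbar hne κ hκ γ _ N _ Dt H ιC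
    P hP
  exact h W p hp.le hord K hK hHN hHp hodd h3 hirrK ι v vbar hv hvbar hne κ hκ γ N Dt H ιC P hP

/-! ### A `p`-adic valuation computation (standard API; no mathematical content of its own) -/

section Valuation

variable {p : ℕ} [hp : Fact p.Prime]

/-- `ord_p` of the right-hand side of the composite: for a unit `u ∈ ℤ_p^×`, `k ∈ ℕ`, integers `c, a`,
`L ∈ ℚ_p` and `m ∈ ℕ`, if `u · p^k · c⁻² · (1 − a p⁻¹ + p⁻¹)² · (L/m)² ≠ 0` then its valuation is
`k + 2·(ord_p(1 − a + p) − 1 + (ord_p L − ord_p m)) − 2·ord_p c` (each factor is non-zero, `ord_p` is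
additive, `1 − a p⁻¹ + p⁻¹ = (1 − a + p)/p`). Private helper, the same computation as the sibling's.
[folklore] -/
private theorem valuation_unit_mul_pow_mul_bdpShape (u : ℤ_[p]ˣ) (k : ℕ) (c a : ℤ) (L : ℚ_[p])
    (m : ℕ)
    (h : ((u : ℤ_[p]) : ℚ_[p]) * (p : ℚ_[p]) ^ k * ((c : ℚ_[p])⁻¹) ^ 2 *
        (1 - (a : ℚ_[p]) * (p : ℚ_[p])⁻¹ + (p : ℚ_[p])⁻¹) ^ 2 * (L / (m : ℚ_[p])) ^ 2 ≠ 0) :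
    (((u : ℤ_[p]) : ℚ_[p]) * (p : ℚ_[p]) ^ k * ((c : ℚ_[p])⁻¹) ^ 2 *
        (1 - (a : ℚ_[p]) * (p : ℚ_[p])⁻¹ + (p : ℚ_[p])⁻¹) ^ 2 * (L / (m : ℚ_[p])) ^ 2).valuation =
      (k : ℤ) + 2 * ((padicValInt p (1 - a + p) : ℤ) - 1 + (L.valuation - (padicValNat p m : ℤ))) -
        2 * (padicValInt p c : ℤ) := by
  have hp0 : (p : ℚ_[p]) ≠ 0 := by exact_mod_cast hp.out.ne_zero
  have hu0 : ((u : ℤ_[p]) : ℚ_[p]) ≠ 0 := PadicInt.coe_ne_zero.2 u.ne_zero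
  have hpk0 : (p : ℚ_[p]) ^ k ≠ 0 := pow_ne_zero k hp0
  have hc0 : ((c : ℚ_[p])⁻¹) ≠ 0 := by
    intro h0; apply h; rw [h0]; ring
  have hA0 : (1 - (a : ℚ_[p]) * (p : ℚ_[p])⁻¹ + (p : ℚ_[p])⁻¹) ≠ 0 := by
    intro h0; apply h; rw [h0]; ring
  have hLm0 : L / (m : ℚ_[p]) ≠ 0 := by
    intro h0; apply h; rw [h0]; ring
  have hL0 : L ≠ 0 := by
    intro h0; apply hLm0; rw [h0, zero_div]
  have hm0 : (m : ℚ_[p]) ≠ 0 := by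
    intro h0; apply hLm0; rw [h0, div_zero]
  -- `1 − a p⁻¹ + p⁻¹ = (1 − a + p)/p`
  have hAeq : (1 - (a : ℚ_[p]) * (p : ℚ_[p])⁻¹ + (p : ℚ_[p])⁻¹) =
      ((1 - a + p : ℤ) : ℚ_[p]) * (p : ℚ_[p])⁻¹ := by
    push_cast
    field_simp
    ring
  have hA1 : ((1 - a + p : ℤ) : ℚ_[p]) ≠ 0 := by
    intro h0; apply hA0; rw [hAeq, h0, zero_mul]
  -- valuations of the five factors
  have hvu : ((u : ℤ_[p]) : ℚ_[p]).valuation = 0 := by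
    simp only [PadicInt.valuation_coe, padicInt_valuation_eq_zero_of_isUnit u.isUnit, Nat.cast_zero]
  have hvpk : ((p : ℚ_[p]) ^ k).valuation = (k : ℤ) := by
    rw [Padic.valuation_pow, Padic.valuation_p]
    ring
  have hvc : ((c : ℚ_[p])⁻¹).valuation = -(padicValInt p c : ℤ) := by
    rw [Padic.valuation_inv, Padic.valuation_intCast]
  have hvA : (1 - (a : ℚ_[p]) * (p : ℚ_[p])⁻¹ + (p : ℚ_[p])⁻¹).valuation =
      (padicValInt p (1 - a + p) : ℤ) - 1 := by
    rw [hAeq, Padic.valuation_mul hA1 (inv_ne_zero hp0), Padic.valuation_intCast,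
      Padic.valuation_inv, Padic.valuation_p]
    ring
  have hvL : (L / (m : ℚ_[p])).valuation = L.valuation - (padicValNat p m : ℤ) := by
    rw [div_eq_mul_inv, Padic.valuation_mul hL0 (inv_ne_zero hm0), Padic.valuation_inv,
      Padic.valuation_natCast]
    ring
  rw [Padic.valuation_mul (mul_ne_zero (mul_ne_zero (mul_ne_zero hu0 hpk0) (pow_ne_zero 2 hc0))
      (pow_ne_zero 2 hA0)) (pow_ne_zero 2 hLm0),
    Padic.valuation_mul (mul_ne_zero (mul_ne_zero hu0 hpk0) (pow_ne_zero 2 hc0)) (pow_ne_zero 2 hA0),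
    Padic.valuation_mul (mul_ne_zero hu0 hpk0) (pow_ne_zero 2 hc0), Padic.valuation_mul hu0 hpk0, hvpk,
    Padic.valuation_pow, Padic.valuation_pow, Padic.valuation_pow, hvu, hvc, hvA, hvL]
  ring

end Valuation

variable {W : WeierstrassCurve ℚ} [W.IsElliptic] [W.IsGloballyMinimal] {p : ℕ} [Fact p.Prime]

/-! ### Bookkeeping consumers (at every `p ≥ 3`) -/

/-- **Every generator satisfies the identity (with its own unit and the SAME exponent `k`).**
Granted the fact, if `Char_Λ(𝒳_{𝓕_Gr}) = (𝓖)` for ANY `𝓖 ∈ Λ`, then `𝓖(0) = u' · p^k · c_E⁻² (1 − a_p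
p⁻¹ + p⁻¹)² log_{ω_E}(P_K)²` for some `u' ∈ ℤ_p^×`, `k ∈ ℕ` (two generators of a principal ideal of the
domain `Λ = ℤ_p⟦T⟧` differ by a unit of `Λ`, whose constant term is a unit of `ℤ_p`).
[cite: YanZhu2024MainConjNonCM, Thm. 5.7 (1) (arXiv:2412.20078v4 l.1217–1223)]
[cite: BurungaleCastellaSkinner2025, Prop. 4.2.2 (p. 9)] -/
theorem generator_constantCoeff_eq_of_thm57 (h : thm57_bcs422_cgls513_generator_constantCoeff)
    (hp : 3 ≤ p) (hord : GoodOrd W p)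
    (K : Type) [Field K] [NumberField K] (hK : IsImaginaryQuadratic K)
    (hHN : SatisfiesHeegnerHypothesis (W.conductorNorm ℤ) K) (hHp : SatisfiesHeegnerHypothesis p K)
    (hodd : Odd (NumberField.discr K)) (h3 : NumberField.discr K ≠ -3)
    (hirrK : (W.baseChange K).HasIrreducibleModPGaloisRep p)
    (ι : K →+* ℚ_[p]) (v vbar : HeightOneSpectrum (𝓞 K))
    (hv : ∀ x : 𝓞 K, x ∈ v.asIdeal ↔ ‖ι (x : K)‖ < 1)
    (hvbar : ((p : ℕ) : 𝓞 K) ∈ vbar.asIdeal) (hne : vbar ≠ v)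
    (κ : ZpExtension K p) (hκ : κ.IsAnticyclotomic)
    (γ : absoluteGaloisGroup K) [Fact (κ.IsTopGenerator γ)]
    {N : ℕ} [NeZero N] (Dt : ModularParametrizationData W N)
    (H : HeegnerDatum N (NumberField.discr K)) (ιC : K →+* ℂ) (P : (W.baseChange K).toAffine.Point)
    (hP : WeierstrassCurve.Affine.Point.map ιC.toRatAlgHom P = heegnerPointComplex Dt H)
    (G : IwasawaAlgebra p) (hG : AcSelmer.XAc.charIdeal (W.baseChange K) p κ vbar ∅ γ = Ideal.span {G}) :
    ∃ (u' : ℤ_[p]ˣ) (k : ℕ),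
      ((PowerSeries.constantCoeff G : ℤ_[p]) : ℚ_[p]) =
        ((u' : ℤ_[p]) : ℚ_[p]) * (p : ℚ_[p]) ^ k * ((Dt.c : ℚ_[p])⁻¹) ^ 2 *
          (1 - (W.frobeniusTrace p : ℚ_[p]) * (p : ℚ_[p])⁻¹ + (p : ℚ_[p])⁻¹) ^ 2 *
          ((W.baseChange ℚ_[p]).padicLogPoint (formalIndex W p • padicPointOf W p ι P) /
            (formalIndex W p : ℚ_[p])) ^ 2 := by
  obtain ⟨-, F, hF, u, k, hu⟩ :=
    h W p hp hord K hK hHN hHp hodd h3 hirrK ι v vbar hv hvbar hne κ hκ γ N Dt H ιC P hP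
  -- `G = F · w` for a unit `w` of `Λ`; `w(0)` is a unit of `ℤ_p`
  obtain ⟨w, rfl⟩ := Ideal.span_singleton_eq_span_singleton.mp (hF.symm.trans hG)
  have hw : IsUnit (PowerSeries.constantCoeff (w : IwasawaAlgebra p)) :=
    PowerSeries.isUnit_constantCoeff _ w.isUnit
  refine ⟨u * hw.unit, k, ?_⟩
  rw [map_mul, PadicInt.coe_mul, hu, Units.val_mul, PadicInt.coe_mul, IsUnit.unit_spec]
  ring

/-- **The identity in valuations, as a ONE-SIDED bound** — the currency of the control facts (JSW
2017 Thm. 3.3.1, printed at `p ≥ 3`) and of the cells' `AcSelmer.XAc.HasCharValuationAt`: granted the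
fact, for EVERY generator `𝓖` of `Char_Λ(𝒳_{𝓕_Gr})` with `𝓖(0) ≠ 0`,
`2·(ord_p(1 − a_p + p) − 1 + ord_p log_{ω_E} P_K) − 2·ord_p c_E ≤ ord_p 𝓖(0)` (the defect is the
exponent `k = μ(𝓖) ≥ 0` of the fact), where `ord_p log_{ω_E} P_K = padicLogOrd W p ι P`. This is
"`𝓛_p^BDP(E/K) ∣ 𝓖` in `Λ^{ur,−}`" read at the trivial character, at every `p ≥ 3`.
[cite: YanZhu2024MainConjNonCM, Thm. 5.7 (1) (arXiv:2412.20078v4 l.1217–1223)]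
[cite: BurungaleCastellaSkinner2025, Prop. 4.2.2 (p. 9)] [cite: CastellaGrossiLeeSkinner2022, Thm. 5.1.3] -/
theorem le_valuation_generator_constantCoeff_of_thm57
    (h : thm57_bcs422_cgls513_generator_constantCoeff)
    (hp : 3 ≤ p) (hord : GoodOrd W p)
    (K : Type) [Field K] [NumberField K] (hK : IsImaginaryQuadratic K)
    (hHN : SatisfiesHeegnerHypothesis (W.conductorNorm ℤ) K) (hHp : SatisfiesHeegnerHypothesis p K)
    (hodd : Odd (NumberField.discr K)) (h3 : NumberField.discr K ≠ -3)
    (hirrK : (W.baseChange K).HasIrreducibleModPGaloisRep p)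
    (ι : K →+* ℚ_[p]) (v vbar : HeightOneSpectrum (𝓞 K))
    (hv : ∀ x : 𝓞 K, x ∈ v.asIdeal ↔ ‖ι (x : K)‖ < 1)
    (hvbar : ((p : ℕ) : 𝓞 K) ∈ vbar.asIdeal) (hne : vbar ≠ v)
    (κ : ZpExtension K p) (hκ : κ.IsAnticyclotomic)
    (γ : absoluteGaloisGroup K) [Fact (κ.IsTopGenerator γ)]
    {N : ℕ} [NeZero N] (Dt : ModularParametrizationData W N)
    (H : HeegnerDatum N (NumberField.discr K)) (ιC : K →+* ℂ) (P : (W.baseChange K).toAffine.Point)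
    (hP : WeierstrassCurve.Affine.Point.map ιC.toRatAlgHom P = heegnerPointComplex Dt H)
    (G : IwasawaAlgebra p) (hG : AcSelmer.XAc.charIdeal (W.baseChange K) p κ vbar ∅ γ = Ideal.span {G})
    (hG0 : PowerSeries.constantCoeff G ≠ 0) :
    2 * ((padicValInt p (1 - W.frobeniusTrace p + p) : ℤ) - 1 + padicLogOrd W p ι P) -
        2 * (padicValInt p Dt.c : ℤ) ≤ ((PowerSeries.constantCoeff G).valuation : ℤ) := by
  obtain ⟨u', k, hu'⟩ := generator_constantCoeff_eq_of_thm57 h hp hord K hK hHN hHp hodd h3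
    hirrK ι v vbar hv hvbar hne κ hκ γ Dt H ιC P hP G hG
  -- the left-hand side is non-zero, hence so is the right-hand side
  have hrhs : ((u' : ℤ_[p]) : ℚ_[p]) * (p : ℚ_[p]) ^ k * ((Dt.c : ℚ_[p])⁻¹) ^ 2 *
      (1 - (W.frobeniusTrace p : ℚ_[p]) * (p : ℚ_[p])⁻¹ + (p : ℚ_[p])⁻¹) ^ 2 *
      ((W.baseChange ℚ_[p]).padicLogPoint (formalIndex W p • padicPointOf W p ι P) /
        (formalIndex W p : ℚ_[p])) ^ 2 ≠ 0 := by
    rw [← hu']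
    exact PadicInt.coe_ne_zero.2 hG0
  have hval := congrArg Padic.valuation hu'
  rw [PadicInt.valuation_coe,
    valuation_unit_mul_pow_mul_bdpShape u' k Dt.c (W.frobeniusTrace p) _ _ hrhs] at hval
  rw [hval, padicLogOrd]
  omega

/-- **Thm. 5.7 (1) + Prop. 4.2.2 ∘ Thm. 5.1.3 at the trivial character in the packaged currency**
`AcSelmer.XAc.HasCharValuationAt … n` ("`𝒳_{𝓕_Gr}` is `Λ`-torsion with a generator `𝓕`, `𝓕(0) ≠ 0`,
`ord_p 𝓕(0) = n`") `∧ 2·(ord_p(1 − a_p + p) − 1 + ord_p log_{ω_E} P_K) − 2·ord_p c_E ≤ n` — granted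
the fact and ONE generator with non-zero constant term (at the cells' data this comes from a control
theorem: JSW Thm. 3.3.1, `p ≥ 3`, which needs (irr_K), NOT (sur)). Up to the Manin term `2·ord_p c_E`
and the log-prime convention this is LITERALLY the body of the cells' Summits predicate
`X11b.IMCLowerWaldspurgerOnTreeGoodAt p κ vbar γ ι P` ((IMC≥∘BDP)ᵍ at `𝟙`), now fed, at EVERY good
ordinary `p ≥ 3` with (irr_K) and WITHOUT any image hypothesis, by published facts — in particular at
`p = 3` (leaf X10b), where the tree had no such input.
[cite: YanZhu2024MainConjNonCM, Thm. 5.7 (1) (arXiv:2412.20078v4 l.1217–1223)]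
[cite: BurungaleCastellaSkinner2025, Prop. 4.2.2 (p. 9)] [cite: CastellaGrossiLeeSkinner2022, Thm. 5.1.3]
[cite: Castella2018, §5 (eq:IMC+BDP) (arXiv:1704.06608 p. 12) (the same shape at `p ∣ N`)] -/
theorem hasCharValuationAt_ge_of_thm57 (h : thm57_bcs422_cgls513_generator_constantCoeff)
    (hp : 3 ≤ p) (hord : GoodOrd W p)
    (K : Type) [Field K] [NumberField K] (hK : IsImaginaryQuadratic K)
    (hHN : SatisfiesHeegnerHypothesis (W.conductorNorm ℤ) K) (hHp : SatisfiesHeegnerHypothesis p K)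
    (hodd : Odd (NumberField.discr K)) (h3 : NumberField.discr K ≠ -3)
    (hirrK : (W.baseChange K).HasIrreducibleModPGaloisRep p)
    (ι : K →+* ℚ_[p]) (v vbar : HeightOneSpectrum (𝓞 K))
    (hv : ∀ x : 𝓞 K, x ∈ v.asIdeal ↔ ‖ι (x : K)‖ < 1)
    (hvbar : ((p : ℕ) : 𝓞 K) ∈ vbar.asIdeal) (hne : vbar ≠ v)
    (κ : ZpExtension K p) (hκ : κ.IsAnticyclotomic)
    (γ : absoluteGaloisGroup K) [Fact (κ.IsTopGenerator γ)]
    {N : ℕ} [NeZero N] (Dt : ModularParametrizationData W N)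
    (H : HeegnerDatum N (NumberField.discr K)) (ιC : K →+* ℂ) (P : (W.baseChange K).toAffine.Point)
    (hP : WeierstrassCurve.Affine.Point.map ιC.toRatAlgHom P = heegnerPointComplex Dt H)
    (G : IwasawaAlgebra p) (hG : AcSelmer.XAc.charIdeal (W.baseChange K) p κ vbar ∅ γ = Ideal.span {G})
    (hG0 : PowerSeries.constantCoeff G ≠ 0) :
    ∃ n : ℕ, AcSelmer.XAc.HasCharValuationAt (W.baseChange K) p κ vbar ∅ γ n ∧
      2 * ((padicValInt p (1 - W.frobeniusTrace p + p) : ℤ) - 1 + padicLogOrd W p ι P) -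
        2 * (padicValInt p Dt.c : ℤ) ≤ (n : ℤ) := by
  obtain ⟨htors, -⟩ :=
    h W p hp hord K hK hHN hHp hodd h3 hirrK ι v vbar hv hvbar hne κ hκ γ N Dt H ιC P hP
  exact ⟨(PowerSeries.constantCoeff G).valuation,
    AcSelmer.XAc.hasCharValuationAt_of_eq htors hG hG0 rfl,
    le_valuation_generator_constantCoeff_of_thm57 h hp hord K hK hHN hHp hodd h3 hirrK ι v vbar
      hv hvbar hne κ hκ γ Dt H ιC P hP G hG hG0⟩

end Literature.NumberTheory.EllipticCurves.YanZhu2026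

end
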